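import Summits.SmoothPoincare4.SmoothPoincare4.Theorems.EntropyRungSubcylindricalExistenceSmoothedConeModelMetric
import Mathlib.Analysis.SpecialFunctions.Integrals.Basic
import Mathlib.MeasureTheory.Constructions.HaarToSphere
import Mathlib.MeasureTheory.Measure.Lebesgue.VolumeOfBalls
import HarnessLib

/-!
# Volume of cone annuli for the smoothed cone `e^{2θ(‖x‖²)} δ` on `ℝ⁴`
(aux file 4 of stub `helper_smoothedConeModel`, line `fat-conical-core-avr-logsobolev`, crux
`EntropyRung.SubcylindricalExistence`, item stmt-SmoothPoincare4-10871)

For a Riemannian metric `g_c(x)(v,w) = e^{2θ(‖x‖²)} ⟪v,w⟫` on `ℝ⁴ = EuclideanSpace ℝ (Fin 4)` whose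
profile is the exact cone of slope `c > 0` outside the unit ball (`θ(s) = log c + ((c−1)/2) log s`
for `s ≥ 1`), the Riemannian measure is `dV_{g_c} = e^{4θ(‖y‖²)} dy`
(`riemannianMeasure_of_conformal` over the flat `dV_δ = dy`, `riemannianMeasure_euclideanFour`), the
unit ball has finite volume, and the cone annuli have the exact conical volume
(`helper_smoothedConeModel_volume`):
`Vol_{g_c} {1 ≤ ‖y‖, ‖y‖^c ≤ T} = ∫_{1 ≤ ‖y‖ ≤ T^{1/c}} c⁴ ‖y‖^{4c−4} dy = (π²/2) c³ (T⁴ − 1)`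
(polar coordinates `integral_fun_norm_addHaar`, `|B⁴| = π²/2`, `integral_rpow`) — the volume of the
ball of radius `T` in the cone `dr² + c² r² g_{S³}` of asymptotic volume ratio `c³`, up to the
constant `(π²/2) c³`. Everything is proved; no definition, no named fact.

References: I. Chavel, *Riemannian Geometry* (2006), §III.3 [Chavel2006]; H. Federer, *Geometric
Measure Theory* (1969), §3.2.46 [Federer1969].
-/

noncomputable section

-- the registered namespace `Summit.SmoothPoincare4.SmoothPoincare4.Theorems` repeats a component
set_option linter.dupNamespace false

open scoped Manifold ContDiff Topology RealInnerProductSpace ENNReal NNReal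
open Set Filter Function MeasureTheory MeasureTheory.Measure Metric
open Literature.Geometry.Lorentzian Literature.Geometry.Riemannian

namespace Summit.SmoothPoincare4.SmoothPoincare4.Theorems

namespace SmoothedConeModelVolume

variable {θ : ℝ → ℝ}
  {gc : PseudoRiemannianMetric 𝓘(ℝ, EuclideanFour) ∞ EuclideanFour
    (TangentSpace 𝓘(ℝ, EuclideanFour) : EuclideanFour → Type _)}
  (hgc : gc.IsRiemannian)
  (hval : ∀ (x : EuclideanFour) (v w : EuclideanFour),
    gc.val x v w = Real.exp (2 * θ (‖x‖ ^ 2)) * ⟪v, w⟫)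

/-! ## `dV_{g_c} = e^{4θ(‖y‖²)} dy` -/

include hval in
/-- **The Riemannian measure of the conformally flat metric** `e^{2θ(‖x‖²)} δ` on `ℝ⁴` is
`e^{4θ(‖y‖²)} dy` (conformal law `dV_{φ δ} = φ² dV_δ` in dimension four, `dV_δ = dy`).
[cite: Chavel2006, §III.3 (III.3.5)] -/
theorem riemannianMeasure_eq_withDensity :
    riemannianMeasure (gc.toContMDiffRiemannianMetric hgc) =
      (volume : Measure EuclideanFour).withDensity
        fun y ↦ ENNReal.ofReal (Real.exp (4 * θ (‖y‖ ^ 2))) := by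
  have hconf : ∀ (p : EuclideanFour) (v w : TangentSpace 𝓘(ℝ, EuclideanFour) p),
      (gc.toContMDiffRiemannianMetric hgc).inner p v w =
        Real.exp (2 * θ (‖p‖ ^ 2)) * euclideanFourMetric.inner p v w := by
    intro p v w
    rw [PseudoRiemannianMetric.toContMDiffRiemannianMetric_inner,
      PseudoRiemannianMetric.toContMDiffRiemannianMetric_inner, hval, euclideanMetric_apply]
    rfl
  rw [riemannianMeasure_of_conformal (gc.toContMDiffRiemannianMetric hgc) euclideanFourMetric hconf,
    riemannianMeasure_euclideanFour]
  congr 1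
  funext p
  rw [show Real.exp (2 * θ (‖p‖ ^ 2)) ^ 4 = Real.exp (4 * θ (‖p‖ ^ 2)) ^ 2 by
      rw [← Real.exp_nat_mul, ← Real.exp_nat_mul]; push_cast; ring_nf,
    Real.sqrt_sq (Real.exp_pos _).le]

/-! ## The density in the cone region -/

/-- For `θ = log c + ((c−1)/2) log` on `[1, ∞)` and `t ≥ 1`: `e^{4θ(t²)} = c⁴ t^{4c−4}`. [folklore] -/
theorem density_cone {c : ℝ} (hc : 0 < c)
    (hcone : ∀ s : ℝ, 1 ≤ s → θ s = Real.log c + (c - 1) / 2 * Real.log s) {t : ℝ} (ht : 1 ≤ t) :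
    Real.exp (4 * θ (t ^ 2)) = c ^ 4 * t ^ (4 * c - 4) := by
  have ht0 : 0 < t := lt_of_lt_of_le one_pos ht
  rw [hcone _ (by nlinarith), Real.log_pow, Real.rpow_def_of_pos ht0]
  push_cast
  rw [show 4 * (Real.log c + (c - 1) / 2 * (2 * Real.log t)) =
      (4 : ℕ) * Real.log c + Real.log t * (4 * c - 4) by push_cast; ring,
    Real.exp_add, Real.exp_nat_mul, Real.exp_log hc]

/-! ## The radial integral -/

/-- The radial integrand `t³ · 𝟙_{[1,R]}(t) c⁴ t^{4c−4} = 𝟙_{[1,R]}(t) c⁴ t^{4c−1}` on `(0, ∞)`. [folklore] -/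
theorem radial_integrand_eq {c R : ℝ} {t : ℝ} (ht : t ∈ Ioi (0 : ℝ)) :
    t ^ 3 • (Icc 1 R).indicator (fun t ↦ c ^ 4 * t ^ (4 * c - 4)) t =
      (Icc 1 R).indicator (fun t ↦ c ^ 4 * t ^ (4 * c - 1)) t := by
  by_cases h : t ∈ Icc 1 R
  · rw [indicator_of_mem h, indicator_of_mem h, smul_eq_mul,
      show t ^ 3 = t ^ (3 : ℝ) by rw [← Real.rpow_natCast]; norm_num,
      show 4 * c - 1 = 3 + (4 * c - 4) by ring, Real.rpow_add (mem_Ioi.1 ht)]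
    ring
  · rw [indicator_of_notMem h, indicator_of_notMem h, smul_zero]

/-- **The radial integral**: `∫₀^∞ t³ 𝟙_{[1,T^{1/c}]} c⁴ t^{4c−4} dt = c³ (T⁴ − 1)/4`, with
integrability, for `c > 0`, `T ≥ 1`. [folklore] -/
theorem radial_integral {c : ℝ} (hc : 0 < c) {T : ℝ} (hT : 1 ≤ T) :
    ∫ t in Ioi (0 : ℝ), t ^ 3 • (Icc 1 (T ^ c⁻¹)).indicator (fun t ↦ c ^ 4 * t ^ (4 * c - 4)) t =
        c ^ 3 * (T ^ 4 - 1) / 4 ∧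
      IntegrableOn (fun t : ℝ ↦ t ^ 3 • (Icc 1 (T ^ c⁻¹)).indicator
        (fun t ↦ c ^ 4 * t ^ (4 * c - 4)) t) (Ioi 0) := by
  set R : ℝ := T ^ c⁻¹ with hR
  have hT0 : 0 < T := lt_of_lt_of_le one_pos hT
  have hR1 : 1 ≤ R := Real.one_le_rpow hT (inv_nonneg.2 hc.le)
  have hcont : ContinuousOn (fun t : ℝ ↦ c ^ 4 * t ^ (4 * c - 1)) (Icc 1 R) :=
    continuousOn_const.mul (continuousOn_of_forall_continuousAt fun t ht ↦
      Real.continuousAt_rpow_const t _ (Or.inl (lt_of_lt_of_le one_pos ht.1).ne'))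
  have hint : IntegrableOn (fun t : ℝ ↦ (Icc 1 R).indicator (fun t ↦ c ^ 4 * t ^ (4 * c - 1)) t)
      (Ioi 0) :=
    ((integrable_indicator_iff measurableSet_Icc).2 (hcont.integrableOn_Icc)).integrableOn
  have hinter : Ioi (0 : ℝ) ∩ Icc 1 R = Icc 1 R :=
    inter_eq_right.2 fun t ht ↦ lt_of_lt_of_le one_pos ht.1
  refine ⟨?_, hint.congr_fun (fun t ht ↦ (radial_integrand_eq ht).symm) measurableSet_Ioi⟩
  rw [setIntegral_congr_fun measurableSet_Ioi fun t ht ↦ radial_integrand_eq ht,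
    setIntegral_indicator measurableSet_Icc, hinter, integral_Icc_eq_integral_Ioc,
    ← intervalIntegral.integral_of_le hR1, intervalIntegral.integral_const_mul,
    integral_rpow (Or.inl (by linarith)), show 4 * c - 1 + 1 = 4 * c by ring, Real.one_rpow, hR,
    ← Real.rpow_mul hT0.le, show c⁻¹ * (4 * c) = (4 : ℕ) by field_simp; norm_num, Real.rpow_natCast]
  have h4c : 4 * c ≠ 0 := by positivity
  field_simp

/-! ## The volume of the cone annulus -/

/-- `|B⁴| = π²/2`. [folklore] -/
theorem volume_real_ball_four : (volume : Measure EuclideanFour).real (ball 0 1) = Real.pi ^ 2 / 2 := by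
  -- adapted from Literature/Geometry/Riemannian/RoundCylinderFourVolume.lean (`integral_Grad_norm`)
  have hdim : Module.finrank ℝ EuclideanFour = 4 := finrank_euclideanSpace_fin
  rw [Measure.real, InnerProductSpace.volume_ball_of_dim_even (k := 2) (by rw [hdim]), hdim]
  rw [ENNReal.toReal_mul, ← ENNReal.ofReal_pow zero_le_one, ENNReal.toReal_ofReal (by positivity),
    ENNReal.toReal_ofReal (by positivity)]
  norm_num

include hval in
/-- **The volume of the cone annulus** `{1 ≤ ‖y‖, ‖y‖^c ≤ T}` for `g_c`: `(π²/2) c³ (T⁴ − 1)`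
(`T ≥ 1`). [folklore] -/
theorem volume_annulus {c : ℝ} (hc : 0 < c)
    (hcone : ∀ s : ℝ, 1 ≤ s → θ s = Real.log c + (c - 1) / 2 * Real.log s) {T : ℝ} (hT : 1 ≤ T) :
    riemannianMeasure (gc.toContMDiffRiemannianMetric hgc)
        {y : EuclideanFour | 1 ≤ ‖y‖ ∧ ‖y‖ ^ c ≤ T} =
      ENNReal.ofReal (Real.pi ^ 2 / 2 * c ^ 3 * (T ^ 4 - 1)) := by
  set R : ℝ := T ^ c⁻¹ with hR
  have hT0 : 0 < T := lt_of_lt_of_le one_pos hT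
  set S : Set EuclideanFour := {y | 1 ≤ ‖y‖ ∧ ‖y‖ ^ c ≤ T} with hS
  have hSm : MeasurableSet S :=
    ((isClosed_le continuous_const continuous_norm).inter
      (isClosed_le (continuous_norm.rpow_const fun _ ↦ Or.inr hc.le) continuous_const)).measurableSet
  have hmem : ∀ y : EuclideanFour, y ∈ S ↔ ‖y‖ ∈ Icc 1 R := fun y ↦ by
    rw [hS, mem_setOf_eq, mem_Icc, hR, Real.le_rpow_inv_iff_of_pos (norm_nonneg y) hT0.le hc]
  set G : ℝ → ℝ := fun t ↦ (Icc 1 R).indicator (fun t ↦ c ^ 4 * t ^ (4 * c - 4)) t with hG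
  have hGnn : ∀ t, 0 ≤ G t := fun t ↦ by
    rw [hG]
    refine indicator_nonneg (fun u hu ↦ ?_) t
    exact mul_nonneg (pow_nonneg hc.le 4) (Real.rpow_nonneg (le_trans zero_le_one hu.1) _)
  -- the measure of `S` as a radial integral
  have h1 : riemannianMeasure (gc.toContMDiffRiemannianMetric hgc) S =
      ∫⁻ y : EuclideanFour, ENNReal.ofReal (G ‖y‖) := by
    rw [riemannianMeasure_eq_withDensity hgc hval, withDensity_apply _ hSm, ← lintegral_indicator hSm]
    refine lintegral_congr fun y ↦ ?_
    by_cases hy : y ∈ S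
    · have hy' := (hmem y).1 hy
      rw [indicator_of_mem hy, hG]
      dsimp only
      rw [indicator_of_mem hy', density_cone hc hcone hy'.1]
    · have hy' : ‖y‖ ∉ Icc 1 R := fun h ↦ hy ((hmem y).2 h)
      rw [indicator_of_notMem hy, hG]
      dsimp only
      rw [indicator_of_notMem hy', ENNReal.ofReal_zero]
  obtain ⟨hI, hint⟩ := radial_integral hc hT
  have hdim : Module.finrank ℝ EuclideanFour = 4 := finrank_euclideanSpace_fin
  have hGint : Integrable (fun y : EuclideanFour ↦ G ‖y‖) := by
    refine (integrable_fun_norm_addHaar (volume : Measure EuclideanFour) (f := G)).2 ?_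
    rw [hdim]
    exact hint
  rw [h1, ← ofReal_integral_eq_lintegral_ofReal hGint (ae_of_all _ fun y ↦ hGnn _),
    integral_fun_norm_addHaar (volume : Measure EuclideanFour) G, hdim, volume_real_ball_four]
  congr 1
  simp only [nsmul_eq_mul, smul_eq_mul, Nat.cast_ofNat]
  have h3 : ∫ t in Ioi (0 : ℝ), t ^ (4 - 1) * G t = c ^ 3 * (T ^ 4 - 1) / 4 := by
    simpa [smul_eq_mul] using hI
  rw [h3]
  ring

end SmoothedConeModelVolume

open SmoothedConeModelVolume in
/-- **Aux 4 of stub `helper_smoothedConeModel`: volumes for the smoothed cone.** For `c > 0`, a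
smooth profile `θ` with `θ(s) = log c + ((c−1)/2) log s` for `s ≥ 1` and a Riemannian metric
`g_c = e^{2θ(‖x‖²)} δ` on `ℝ⁴`: the unit ball has finite `g_c`-volume and the cone annuli have
`Vol_{g_c}{1 ≤ ‖y‖, ‖y‖^c ≤ T} = (π²/2) c³ (T⁴ − 1)` for `T ≥ 1` (`dV_{g_c} = e^{4θ(‖y‖²)} dy`,
polar coordinates, `|B⁴| = π²/2`). [folklore] -/
theorem helper_smoothedConeModel_volume :
    ∀ c : ℝ, 0 < c → ∀ θ : ℝ → ℝ, ContDiff ℝ ∞ θ →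
      (∀ s : ℝ, 1 ≤ s → θ s = Real.log c + (c - 1) / 2 * Real.log s) →
      ∀ (gc : PseudoRiemannianMetric (𝓡 4) ∞ (EuclideanSpace ℝ (Fin 4))
          (TangentSpace (𝓡 4) : EuclideanSpace ℝ (Fin 4) → Type _)) (hgc : gc.IsRiemannian),
        (∀ (x : EuclideanSpace ℝ (Fin 4)) (v w : EuclideanSpace ℝ (Fin 4)),
          gc.val x v w = Real.exp (2 * θ (‖x‖ ^ 2)) * ⟪v, w⟫) →
        riemannianMeasure (gc.toContMDiffRiemannianMetric hgc)
            (Metric.ball (0 : EuclideanSpace ℝ (Fin 4)) 1) < ⊤ ∧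
          ∀ T : ℝ, 1 ≤ T →
            riemannianMeasure (gc.toContMDiffRiemannianMetric hgc)
                {y : EuclideanSpace ℝ (Fin 4) | 1 ≤ ‖y‖ ∧ ‖y‖ ^ c ≤ T} =
              ENNReal.ofReal (Real.pi ^ 2 / 2 * c ^ 3 * (T ^ 4 - 1)) := by
  intro c hc θ _ hcone gc hgc hval
  refine ⟨?_, fun T hT ↦ volume_annulus hgc hval hc hcone hT⟩
  have hK := riemannianVolume_lt_top_of_isCompact_holds (gc.toContMDiffRiemannianMetric hgc)
    (d := Module.finrank ℝ (EuclideanSpace ℝ (Fin 4))) le_rfl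
    (isCompact_closedBall (0 : EuclideanSpace ℝ (Fin 4)) 1)
  exact lt_of_le_of_lt (measure_mono ball_subset_closedBall) hK

end Summit.SmoothPoincare4.SmoothPoincare4.Theorems
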